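import Mathlib
import Literature.NumberTheory.LFunctions.Zhang2022.Section16AEq1612Assembly
import Literature.NumberTheory.LFunctions.MontgomeryOffDiagonalTools
import HarnessLib

/-!
# Zhang (2022) §16, (16.5) from (16.3) and §16.u018: "Inserting this into (16.3) and rewriting `d`, `l`
# and `m` for `d₂`, `l₂` and `d₁` respectively, we obtain `Φ₂(p) = (ℛ₂*Dp/φ(D)) ΣΣ b₁(dl)χ(l)/(dl)·𝒟₂(d,l)
# + o(p)`" — the ASSEMBLY EDGE `u018 ⇒ (16.5)ᴾ`, kernel-checked

Topic `Literature/NumberTheory/LFunctions/Zhang2022` (Landau–Siegel audit tree; verdict-neutral).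
Y. Zhang, *Discrete mean estimates and the Landau–Siegel zero*, arXiv:2211.02515v1 (2022)
[Zhang2022LandauSiegel] — **an unrefereed manuscript under adjudication** (ZHANG-L discharge lane, WP16,
chain of the leaf `Typed.Section16A.Eq16_12 c′`). The displays are CLAIM nodes of
`Zhang2022/TypedSection16A.lean`, stated not asserted: (16.3) `Phi2p` (object), §16.u018 `Step16_u018`
[Z22 p. 90, tex L4502], §16.u019 `calD2` (object), (16.5) in its `o(p)` reading `Eq16_5P` [Z22 p. 91, tex
L4509] (the printed `o(1)` of (16.5) is the flagged PRINT defect `Eq16_5`; (16.12) prints `o(p)`).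

This theorem-only file PROVES the step as an EDGE `eq16_5P_of_u018 : Step16_u018 c′ → Eq16_5P c′`:

* `main165_eq` — the EXACT identity behind "rewriting `d`, `l` and `m` for `d₂`, `l₂` and `d₁`":
  `Σ_{k≤2P₄} μχ(k)/φ(k)·[Σ_{d₁,d₂≤2P₄} g̃₂(d₁d₂k)/(d₁d₂)·κ̃₂(d₁;d₂k)λ₂(d₁d₂k)·Σ_{(l₂,k)=1} b₁(d₂l₂)χ(l₂)/l₂]
   = Σ_{d<⌈P⌉}Σ_{l<⌈P⌉} b₁(dl)χ(l)/(dl)·𝒟₂(d,l)` (`log D ≥ 10`): an exchange of finite sums; the two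
  `d`-ranges (`d₂ ≤ 2P₄` on the left, `d < ⌈P⌉` on the right) agree because `g̃₂(mdk) = 0` for
  `d > 2P₄` (`Typed.Section16ALeaves.gTilde16_eq_zero_of_le`) and `b₁(dl) = 0` for `d ≥ P`
  (`b1coef_eq_zero_of_le`, `suppBound_le_bigP`);
* `eq16_5P_of_u018` — with (16.3) (`φ(D)⁻¹Σ_k μχ(k)/(kφ(k))·[…]`) the `k` cancels against the `Dpk` of
  u018's main term, and the error is `φ(D)⁻¹Σ_{k≤2P₄}|μχ(k)|/(kφ(k))·Cα²⁰Dpk ≤ Cα²⁰(D/φ(D))p·Σ_{k≤2P₄}φ(k)⁻¹`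
  `≪ 𝓛⁻¹⁸⁰·𝓛²·𝓛⁹·p = o(p)` (`Montgomery.sum_Icc_inv_totient_le`: `Σ_{k≤M}φ(k)⁻¹ ≤ 7 + 12 log M`;
  `D/φ(D) ≪ 𝓛²` under (A): `Typed.Section16A.self_div_totient_le_ell_sq`; `α = π𝓛⁻⁹`).

No new definitions, no named facts, no `sorry`; u018 is a hypothesis, never asserted; the `k = 2P₄` edge of
u018's range (`k < 2P₄` there, `k ≤ ⌊2P₄⌋` in (16.3)) is harmless: all `g̃₂(dk)` vanish then. Nothing here
bears on Theorems 1–2 of the source or on Landau–Siegel zeros.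

## References

* Y. Zhang, arXiv:2211.02515v1 (2022), §16 (16.3) p. 89 tex L4453, u018 p. 90 tex L4502, u019/(16.5) p. 91
  tex L4509–L4515. [cite: Zhang2022LandauSiegel, §16 (16.5) p.91]
-/

noncomputable section

open Complex Real
open Literature.NumberTheory.LFunctions.Zhang2022
open Literature.NumberTheory.LFunctions.Zhang2022.Skeleton
open Literature.NumberTheory.LFunctions.Zhang2022.Typed.Section16ALeaves

namespace Literature.NumberTheory.LFunctions.Zhang2022.Typed.Section16A

section Main

variable (c' : ℝ) {D : ℕ} (χ : DirichletCharacter ℂ D)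

/-! ## Vanishing outside the ranges -/

/-- `g̃₂(mdk) = 0` as soon as `d > ⌊2P₄⌋` (`m, k ≥ 1`): then `mdk ≥ d > 2P₄`.
[cite: Zhang2022LandauSiegel, §16 p.89 (u009)] -/
theorem gTilde16_mdk_eq_zero {m d k : ℕ} (hm : 1 ≤ m) (hk : 1 ≤ k) (hd : ⌊2 * P4 D⌋₊ < d) :
    gTilde16 c' D ((m * d * k : ℕ) : ℝ) = 0 := by
  have hd' : 2 * P4 D < d := Nat.lt_of_floor_lt hd
  have hd0 : 0 < d := by
    have := P4_nonneg D
    exact_mod_cast (show (0 : ℝ) < d by linarith)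
  have hle : (d : ℝ) ≤ ((m * d * k : ℕ) : ℝ) := by
    have h1 : d ≤ m * d * k := by
      calc d = 1 * d * 1 := by ring
        _ ≤ m * d * k := Nat.mul_le_mul (Nat.mul_le_mul hm le_rfl) hk
    exact_mod_cast h1
  exact gTilde16_eq_zero_of_le c' (by positivity) (by linarith)

/-- `𝒟₂(d,l) = 0` for `d > ⌊2P₄⌋` (every `g̃₂(mdk)` in it vanishes). [cite: Zhang2022LandauSiegel, §16 p.91 (u019)] -/
theorem calD2_eq_zero_of_lt {d : ℕ} (hd : ⌊2 * P4 D⌋₊ < d) (l : ℕ) : calD2 c' χ d l = 0 := by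
  unfold calD2
  refine Finset.sum_eq_zero fun k hk => ?_
  have hk1 : 1 ≤ k := (Finset.mem_Icc.mp (Finset.mem_filter.mp hk).1).1
  rw [Finset.sum_eq_zero fun m hm => ?_, mul_zero]
  have hm1 : 1 ≤ m := (Finset.mem_Icc.mp hm).1
  rw [gTilde16_mdk_eq_zero c' hm1 hk1 hd, mul_zero, zero_div]

/-- Two finite ranges carry the same sum when the summand vanishes off both:
`Σ_{1≤d<N} f(d) = Σ_{1≤d≤K} f(d)` if `f(d) = 0` for `d > K` and for `d ≥ N`. [folklore] -/
private theorem sum_Ico_eq_sum_Icc_of_vanish {M : Type*} [AddCommMonoid M] {K N : ℕ} (f : ℕ → M)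
    (hK : ∀ d, K < d → f d = 0) (hN : ∀ d, N ≤ d → f d = 0) :
    ∑ d ∈ Finset.Ico 1 N, f d = ∑ d ∈ Finset.Icc 1 K, f d := by
  have h1 : ∑ d ∈ Finset.Ico 1 N, f d = ∑ d ∈ Finset.Icc 1 (K + N), f d := by
    refine Finset.sum_subset (fun d hd => ?_) (fun d hd hnot => ?_)
    · simp only [Finset.mem_Ico] at hd; simp only [Finset.mem_Icc]; omega
    · simp only [Finset.mem_Icc] at hd; simp only [Finset.mem_Ico, not_and, not_lt] at hnot
      exact hN d (hnot hd.1)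
  have h2 : ∑ d ∈ Finset.Icc 1 K, f d = ∑ d ∈ Finset.Icc 1 (K + N), f d := by
    refine Finset.sum_subset (fun d hd => ?_) (fun d hd hnot => ?_)
    · simp only [Finset.mem_Icc] at hd ⊢; omega
    · simp only [Finset.mem_Icc] at hd; simp only [Finset.mem_Icc, not_and, not_le] at hnot
      exact hK d (hnot hd.1)
  rw [h1, h2]

/-! ## The exact identity "rewriting `d`, `l`, `m` for `d₂`, `l₂`, `d₁`" -/

/-- **The exact identity behind (16.5)**: for `log D ≥ 10`,
`Σ_{k≤2P₄} μχ(k)/φ(k)·Σ_{d₁,d₂≤2P₄} g̃₂(d₁d₂k)/(d₁d₂)·κ̃₂(d₁;d₂k)λ₂(d₁d₂k)·Σ_{l₂<⌈P⌉,(l₂,k)=1} b₁(d₂l₂)χ(l₂)/l₂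
 = Σ_{d<⌈P⌉}Σ_{l<⌈P⌉} b₁(dl)χ(l)/(dl)·𝒟₂(d,l)` (`𝒟₂` = `calD2`, §16.u019). [cite: Zhang2022LandauSiegel, §16 (16.5) p.91] -/
theorem main165_eq (hℓ : 10 ≤ ell D) :
    ∑ k ∈ Finset.Icc 1 ⌊2 * P4 D⌋₊,
        (ArithmeticFunction.moebius k : ℂ) * χ (k : ZMod D) / (Nat.totient k : ℂ) *
          ∑ d₁ ∈ Finset.Icc 1 ⌊2 * P4 D⌋₊, ∑ d₂ ∈ Finset.Icc 1 ⌊2 * P4 D⌋₊,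
            gTilde16 c' D ((d₁ * d₂ * k : ℕ) : ℝ) / ((d₁ : ℂ) * d₂) *
              kappaTilde2 c' χ d₁ (d₂ * k) 1 * lam2 c' χ (d₁ * d₂ * k) 1 *
              ∑ l₂ ∈ (Finset.Ico 1 ⌈bigP D⌉₊).filter (fun l₂ => Nat.Coprime l₂ k),
                b1coef c' χ (d₂ * l₂) * χ (l₂ : ZMod D) / (l₂ : ℂ) =
      ∑ d ∈ Finset.Ico 1 ⌈bigP D⌉₊, ∑ l ∈ Finset.Ico 1 ⌈bigP D⌉₊,
        b1coef c' χ (d * l) * χ (l : ZMod D) / ((d : ℂ) * l) * calD2 c' χ d l := by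
  set K : ℕ := ⌊2 * P4 D⌋₊ with hK
  set N : ℕ := ⌈bigP D⌉₊ with hN
  -- abbreviations
  set cμ : ℕ → ℂ := fun k => (ArithmeticFunction.moebius k : ℂ) * χ (k : ZMod D) / (Nat.totient k : ℂ)
    with hcμ
  set G : ℕ → ℕ → ℕ → ℂ := fun m d k =>
    kappaTilde2 c' χ m (d * k) 1 * lam2 c' χ (m * d * k) 1 * gTilde16 c' D ((m * d * k : ℕ) : ℝ) / (m : ℂ)
    with hG
  set w : ℕ → ℕ → ℂ := fun d l => b1coef c' χ (d * l) * χ (l : ZMod D) / (l : ℂ) with hw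
  set H : ℕ → ℕ → ℂ := fun k d => cμ k * ∑ m ∈ Finset.Icc 1 K, G m d k with hH
  -- `𝒟₂(d,l) = Σ_{k ≤ K, (k,l)=1} H k d`
  have hD2 : ∀ d l : ℕ, calD2 c' χ d l =
      ∑ k ∈ Finset.Icc 1 K, if Nat.Coprime l k then H k d else 0 := by
    intro d l
    rw [calD2, Finset.sum_filter]
    refine Finset.sum_congr rfl fun k _ => ?_
    by_cases h : Nat.Coprime k l
    · rw [if_pos h, if_pos h.symm]
    · rw [if_neg h, if_neg (fun h' => h h'.symm)]
  -- Step 1: the left side as `Σ_k Σ_{d ≤ K} Σ_{l < N} [ (l,k)=1 ] (H k d / d)·w d l`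
  have hL : ∀ k ∈ Finset.Icc 1 K,
      cμ k * ∑ d₁ ∈ Finset.Icc 1 K, ∑ d₂ ∈ Finset.Icc 1 K,
          gTilde16 c' D ((d₁ * d₂ * k : ℕ) : ℝ) / ((d₁ : ℂ) * d₂) *
            kappaTilde2 c' χ d₁ (d₂ * k) 1 * lam2 c' χ (d₁ * d₂ * k) 1 *
            ∑ l₂ ∈ (Finset.Ico 1 N).filter (fun l₂ => Nat.Coprime l₂ k), w d₂ l₂ =
        ∑ d ∈ Finset.Icc 1 K, ∑ l ∈ Finset.Ico 1 N,
          if Nat.Coprime l k then H k d / (d : ℂ) * w d l else 0 := by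
    intro k _
    rw [Finset.sum_comm, Finset.mul_sum]
    refine Finset.sum_congr rfl fun d _ => ?_
    have hre : ∑ m ∈ Finset.Icc 1 K, gTilde16 c' D ((m * d * k : ℕ) : ℝ) / ((m : ℂ) * d) *
        kappaTilde2 c' χ m (d * k) 1 * lam2 c' χ (m * d * k) 1 =
        (∑ m ∈ Finset.Icc 1 K, G m d k) / (d : ℂ) := by
      rw [Finset.sum_div]
      refine Finset.sum_congr rfl fun m _ => ?_
      simp only [hG]
      ring
    rw [Finset.sum_filter, ← Finset.sum_mul, hre, Finset.mul_sum, Finset.mul_sum]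
    refine Finset.sum_congr rfl fun l _ => ?_
    split_ifs
    · simp only [hH]; ring
    · simp
  rw [Finset.sum_congr rfl hL]
  -- Step 2: the right side's `d`-range `Ico 1 N` ↦ `Icc 1 K`
  have hR : ∑ d ∈ Finset.Ico 1 N, ∑ l ∈ Finset.Ico 1 N,
      b1coef c' χ (d * l) * χ (l : ZMod D) / ((d : ℂ) * l) * calD2 c' χ d l =
      ∑ d ∈ Finset.Icc 1 K, ∑ l ∈ Finset.Ico 1 N,
        b1coef c' χ (d * l) * χ (l : ZMod D) / ((d : ℂ) * l) * calD2 c' χ d l := by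
    refine sum_Ico_eq_sum_Icc_of_vanish _ (fun d hd => ?_) (fun d hd => ?_)
    · exact Finset.sum_eq_zero fun l _ => by rw [calD2_eq_zero_of_lt c' χ hd, mul_zero]
    · refine Finset.sum_eq_zero fun l hl => ?_
      have hl1 : 1 ≤ l := (Finset.mem_Ico.mp hl).1
      have hdl : N ≤ d * l := le_trans hd (Nat.le_mul_of_pos_right _ hl1)
      rw [b1coef_eq_zero_of_le c' χ ((suppBound_le_bigP hℓ).trans
        ((Nat.le_ceil _).trans (by exact_mod_cast hdl)))]
      simp
  rw [hR]
  -- Step 3: reorder `Σ_k Σ_d Σ_l` ↦ `Σ_d Σ_l Σ_k` and compare termwise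
  rw [Finset.sum_comm]
  refine Finset.sum_congr rfl fun d _ => ?_
  rw [Finset.sum_comm]
  refine Finset.sum_congr rfl fun l _ => ?_
  rw [hD2, Finset.mul_sum]
  refine Finset.sum_congr rfl fun k _ => ?_
  split_ifs
  · simp only [hw]; ring
  · simp

/-! ## `Σ_{k ≤ 2P₄} 1/φ(k) ≪ 𝓛⁹` -/

omit χ in
/-- `Σ_{1≤k≤⌊2P₄⌋} 1/φ(k) ≤ 6300𝓛⁹` for `𝓛 ≥ 1` (`Montgomery.sum_Icc_inv_totient_le`: `Σ_{k≤M}φ(k)⁻¹ ≤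
7 + 12 log M`; `2P₄ = 2Pt₀T⁻² ≤ 2Pt₀`, `log(2Pt₀) = log 2 + 𝓛⁹ + 519 log 𝓛 ≤ 1 + 520𝓛⁹`).
[cite: Zhang2022LandauSiegel, §16 (16.3) p.89] -/
theorem sum_inv_totient_le_P4 (hℓ : 1 ≤ ell D) :
    ∑ k ∈ Finset.Icc 1 ⌊2 * P4 D⌋₊, 1 / (Nat.totient k : ℝ) ≤ 6300 * ell D ^ 9 := by
  have h := Literature.NumberTheory.LFunctions.Montgomery.sum_Icc_inv_totient_le ⌊2 * P4 D⌋₊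
  refine h.trans ?_
  have hℓ0 : 0 < ell D := by linarith
  have hP0 : 0 < bigP D := Real.exp_pos _
  have ht0 : 0 < t0 D := by rw [t0]; positivity
  have hT1 : 1 ≤ bigT D ^ 2 := one_le_pow₀ (by rw [bigT]; exact Real.one_le_exp (by positivity))
  have hP4le : 2 * P4 D ≤ 2 * (bigP D * t0 D) := by
    rw [P4]
    have : bigP D / bigT D ^ 2 * t0 D ≤ bigP D * t0 D :=
      mul_le_mul_of_nonneg_right (div_le_self hP0.le hT1) ht0.le
    linarith
  have hlog : Real.log (⌊2 * P4 D⌋₊ : ℝ) ≤ 1 + 520 * ell D ^ 9 := by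
    rcases Nat.eq_zero_or_pos ⌊2 * P4 D⌋₊ with h0 | hpos
    · rw [h0, Nat.cast_zero, Real.log_zero]; positivity
    have hKpos : (0 : ℝ) < (⌊2 * P4 D⌋₊ : ℝ) := by exact_mod_cast hpos
    have hKle : (⌊2 * P4 D⌋₊ : ℝ) ≤ 2 * (bigP D * t0 D) :=
      (Nat.floor_le (by linarith [P4_nonneg D])).trans hP4le
    have hlog2 : Real.log 2 < 1 := by linarith [Real.log_two_lt_d9]
    have hlogt : Real.log (t0 D) ≤ 519 * ell D := by
      rw [t0, Real.log_pow]
      push_cast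
      exact mul_le_mul_of_nonneg_left (Real.log_le_self hℓ0.le) (by norm_num)
    have hℓ9 : ell D ≤ ell D ^ 9 := le_self_pow₀ hℓ (by norm_num)
    calc Real.log (⌊2 * P4 D⌋₊ : ℝ) ≤ Real.log (2 * (bigP D * t0 D)) := Real.log_le_log hKpos hKle
      _ = Real.log 2 + (ell D ^ 9 + Real.log (t0 D)) := by
          rw [Real.log_mul (by norm_num) (by positivity), Real.log_mul hP0.ne' ht0.ne', bigP, Real.log_exp]
      _ ≤ 1 + (ell D ^ 9 + 519 * ell D) := by linarith
      _ ≤ 1 + 520 * ell D ^ 9 := by nlinarith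
  have hℓ9' : 1 ≤ ell D ^ 9 := one_le_pow₀ hℓ
  nlinarith

omit χ in
/-- `α²⁰·𝓛¹¹ ≤ π²⁰/𝓛` for `𝓛 ≥ 1` (`α𝓛⁹ = π`). [cite: Zhang2022LandauSiegel, §2 (2.10)] -/
private theorem alpha_pow_twenty_mul_le (hℓ : 1 ≤ ell D) :
    alpha D ^ 20 * ell D ^ 11 ≤ π ^ 20 / ell D := by
  have hℓ0 : 0 < ell D := by linarith
  have hα := alpha_mul_ell_pow_nine (D := D) hℓ0
  have hα0 : 0 ≤ alpha D := (alpha_pos_of_ell_pos hℓ0).le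
  have key : alpha D ^ 20 * ell D ^ 11 * ell D ^ 169 = π ^ 20 := by
    rw [← hα]; ring
  rw [le_div_iff₀ hℓ0]
  have h169 : ell D ≤ ell D ^ 169 := le_self_pow₀ hℓ (by norm_num)
  calc alpha D ^ 20 * ell D ^ 11 * ell D ≤ alpha D ^ 20 * ell D ^ 11 * ell D ^ 169 := by
        gcongr
    _ = π ^ 20 := key

/-! ## (16.5)ᴾ from §16.u018 -/

/-- **(16.5) in the `o(p)` reading ⇐ §16.u018** (§16 pp. 90–91, tex L4502–L4515: "Hence [u018] … Inserting
this into (16.3) and rewriting `d`, `l` and `m` for `d₂`, `l₂` and `d₁` respectively, we obtain (16.5)"):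
`Step16_u018 c′ → Eq16_5P c′`. The `k` of (16.3)'s weight `μχ(k)/(kφ(k))` cancels against the `Dpk` of
u018's main term (exact identity `main165_eq`), and u018's error `O(α²⁰Dpk)` sums to
`≤ Cα²⁰(D/φ(D))p·Σ_{k≤2P₄}φ(k)⁻¹ ≪ 𝓛^{2+9−180}p = o(p)`. [cite: Zhang2022LandauSiegel, §16 (16.5) p.91] -/
theorem eq16_5P_of_u018 (h18 : Step16_u018 c') : Eq16_5P c' := by
  intro ε hε
  obtain ⟨C, h18'⟩ := h18
  set C' : ℝ := max C 0 with hC'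
  have hC'0 : 0 ≤ C' := le_max_right _ _
  -- the constant in front of `𝓛⁻¹`
  set M : ℝ := C' * (16 * Real.exp (11 / 2)) * 6300 * π ^ 20 with hM
  have hM0 : 0 ≤ M := by positivity
  obtain ⟨D₁, h₁⟩ := h18'.and (self_div_totient_le_ell_sq)
  obtain ⟨D₂, hD₂⟩ := exists_forall_le_ell (max 10 (M / ε + 1))
  refine ⟨max D₁ D₂, fun D _ χ hD hq hp hA p hpW => ?_⟩
  have hD₁ : D₁ ≤ D := le_trans (le_max_left _ _) hD
  have hℓM := hD₂ D (le_trans (le_max_right _ _) hD)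
  have hℓ10 : 10 ≤ ell D := le_trans (le_max_left _ _) hℓM
  have hℓε : M / ε + 1 ≤ ell D := le_trans (le_max_right _ _) hℓM
  have hℓ1 : 1 ≤ ell D := by linarith
  have hℓ0 : 0 < ell D := by linarith
  obtain ⟨e18, eφ⟩ := h₁ D χ hD₁ hq hp
  have h18p := e18 hA p hpW
  have hφle := eφ hA
  set K : ℕ := ⌊2 * P4 D⌋₊ with hK
  set N : ℕ := ⌈bigP D⌉₊ with hN
  set R : ℂ := calR2star c' χ with hR
  have hp0 : 0 < p := (Finset.mem_filter.mp hpW).2.pos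
  have hpR : (0 : ℝ) < p := by exact_mod_cast hp0
  have hD0 : (0 : ℝ) < D := by exact_mod_cast NeZero.pos D
  have hφ0 : 0 < (Nat.totient D : ℝ) := by exact_mod_cast Nat.totient_pos.mpr (NeZero.pos D)
  have hα0 : 0 ≤ alpha D := (alpha_pos_of_ell_pos hℓ0).le
  -- the two `k`-indexed families of u018
  set A : ℕ → ℂ := fun k => ∑ d ∈ Finset.Icc 1 K, gTilde16 c' D ((d * k : ℕ) : ℝ) / (d : ℂ) *
      ∑' l : ℕ, if Nat.Coprime l k then
        kappa2Star c' χ (d * l) * χ (l : ZMod D) * DeltaW D ((l : ℝ) / ((D : ℝ) * p * k)) else 0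
    with hA
  set B : ℕ → ℂ := fun k => ∑ d₁ ∈ Finset.Icc 1 K, ∑ d₂ ∈ Finset.Icc 1 K,
      gTilde16 c' D ((d₁ * d₂ * k : ℕ) : ℝ) / ((d₁ : ℂ) * d₂) *
        kappaTilde2 c' χ d₁ (d₂ * k) 1 * lam2 c' χ (d₁ * d₂ * k) 1 *
        ∑ l₂ ∈ (Finset.Ico 1 N).filter (fun l₂ => Nat.Coprime l₂ k),
          b1coef c' χ (d₂ * l₂) * χ (l₂ : ZMod D) / (l₂ : ℂ) with hB
  -- per-`k` bound (the edge `k = 2P₄` included: there both sides vanish)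
  have hk : ∀ k ∈ Finset.Icc 1 K,
      ‖A k - R * ((D : ℝ) * p * k : ℝ) * B k‖ ≤ C' * alpha D ^ 20 * ((D : ℝ) * p * k) := by
    intro k hkK
    have hk1 : 1 ≤ k := (Finset.mem_Icc.mp hkK).1
    by_cases hlt : (k : ℝ) < 2 * P4 D
    · refine (h18p k hk1 hlt).trans ?_
      gcongr
      exact le_max_left _ _
    · have hge : 2 * P4 D ≤ k := not_lt.mp hlt
      have hg : ∀ n : ℕ, 1 ≤ n → gTilde16 c' D ((n * k : ℕ) : ℝ) = 0 := by
        intro n hn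
        have hnk : (k : ℝ) ≤ ((n * k : ℕ) : ℝ) := by exact_mod_cast Nat.le_mul_of_pos_left k hn
        exact gTilde16_eq_zero_of_le c' (by positivity) (hge.trans hnk)
      have hA0 : A k = 0 := Finset.sum_eq_zero fun d hd => by
        rw [hg d (Finset.mem_Icc.mp hd).1, zero_div, zero_mul]
      have hB0 : B k = 0 := Finset.sum_eq_zero fun d₁ hd₁ => Finset.sum_eq_zero fun d₂ hd₂ => by
        rw [hg (d₁ * d₂) (Nat.one_le_iff_ne_zero.mpr (Nat.mul_ne_zero
          (by linarith [(Finset.mem_Icc.mp hd₁).1]) (by linarith [(Finset.mem_Icc.mp hd₂).1]))),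
          zero_div, zero_mul, zero_mul, zero_mul]
      rw [hA0, hB0, mul_zero, sub_zero, norm_zero]
      positivity
  -- (16.3) unfolded
  have hPhi : Phi2p c' χ p = (Nat.totient D : ℂ)⁻¹ * ∑ k ∈ Finset.Icc 1 K,
      (ArithmeticFunction.moebius k : ℂ) * χ (k : ZMod D) / ((k : ℂ) * Nat.totient k) * A k := rfl
  -- the main term, `k` cancelled, and `main165_eq`
  have hmainK : ∀ k ∈ Finset.Icc 1 K,
      (Nat.totient D : ℂ)⁻¹ * ((ArithmeticFunction.moebius k : ℂ) * χ (k : ZMod D) /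
        ((k : ℂ) * Nat.totient k) * (R * ((D : ℝ) * p * k : ℝ) * B k)) =
      R * ((D : ℝ) * p : ℝ) / (Nat.totient D : ℂ) *
        ((ArithmeticFunction.moebius k : ℂ) * χ (k : ZMod D) / (Nat.totient k : ℂ) * B k) := by
    intro k hkK
    have hk0 : (k : ℂ) ≠ 0 := by exact_mod_cast (show k ≠ 0 by linarith [(Finset.mem_Icc.mp hkK).1])
    have hφk : (Nat.totient k : ℂ) ≠ 0 := by
      exact_mod_cast (Nat.totient_pos.mpr (by linarith [(Finset.mem_Icc.mp hkK).1])).ne'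
    have hφD : (Nat.totient D : ℂ) ≠ 0 := by exact_mod_cast hφ0.ne'
    push_cast
    field_simp
  have hmain : (Nat.totient D : ℂ)⁻¹ * ∑ k ∈ Finset.Icc 1 K,
      (ArithmeticFunction.moebius k : ℂ) * χ (k : ZMod D) / ((k : ℂ) * Nat.totient k) *
        (R * ((D : ℝ) * p * k : ℝ) * B k) =
      R * ((D : ℝ) * p : ℝ) / (Nat.totient D : ℂ) *
        ∑ d ∈ Finset.Ico 1 N, ∑ l ∈ Finset.Ico 1 N,
          b1coef c' χ (d * l) * χ (l : ZMod D) / ((d : ℂ) * l) * calD2 c' χ d l := by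
    rw [← main165_eq c' χ hℓ10, Finset.mul_sum, Finset.mul_sum]
    exact Finset.sum_congr rfl hmainK
  -- the difference
  have hdiff : Phi2p c' χ p - R * ((D : ℝ) * p : ℝ) / (Nat.totient D : ℂ) *
      ∑ d ∈ Finset.Ico 1 N, ∑ l ∈ Finset.Ico 1 N,
        b1coef c' χ (d * l) * χ (l : ZMod D) / ((d : ℂ) * l) * calD2 c' χ d l =
      (Nat.totient D : ℂ)⁻¹ * ∑ k ∈ Finset.Icc 1 K,
        (ArithmeticFunction.moebius k : ℂ) * χ (k : ZMod D) / ((k : ℂ) * Nat.totient k) *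
          (A k - R * ((D : ℝ) * p * k : ℝ) * B k) := by
    rw [hPhi, ← hmain, ← mul_sub, ← Finset.sum_sub_distrib]
    congr 1
    refine Finset.sum_congr rfl fun k _ => ?_
    ring
  rw [hdiff]
  -- norms
  have hcoef : ∀ k ∈ Finset.Icc 1 K,
      ‖(ArithmeticFunction.moebius k : ℂ) * χ (k : ZMod D) / ((k : ℂ) * Nat.totient k) *
          (A k - R * ((D : ℝ) * p * k : ℝ) * B k)‖ ≤
        C' * alpha D ^ 20 * ((D : ℝ) * p) * (1 / (Nat.totient k : ℝ)) := by
    intro k hkK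
    have hk1 : 1 ≤ k := (Finset.mem_Icc.mp hkK).1
    have hkR : (0 : ℝ) < k := by exact_mod_cast hk1
    have hφk : (0 : ℝ) < Nat.totient k := by exact_mod_cast Nat.totient_pos.mpr hk1
    have hμ : ‖(ArithmeticFunction.moebius k : ℂ)‖ ≤ 1 := by
      rw [Complex.norm_intCast]; exact_mod_cast ArithmeticFunction.abs_moebius_le_one
    have hχ : ‖χ (k : ZMod D)‖ ≤ 1 := DirichletCharacter.norm_le_one χ _
    have hc : ‖(ArithmeticFunction.moebius k : ℂ) * χ (k : ZMod D) / ((k : ℂ) * Nat.totient k)‖ ≤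
        1 / ((k : ℝ) * Nat.totient k) := by
      rw [norm_div, norm_mul, norm_mul, Complex.norm_natCast, Complex.norm_natCast]
      refine div_le_div_of_nonneg_right ?_ (by positivity)
      calc ‖(ArithmeticFunction.moebius k : ℂ)‖ * ‖χ (k : ZMod D)‖ ≤ 1 * 1 :=
            mul_le_mul hμ hχ (norm_nonneg _) zero_le_one
        _ = 1 := one_mul _
    rw [norm_mul]
    calc ‖(ArithmeticFunction.moebius k : ℂ) * χ (k : ZMod D) / ((k : ℂ) * Nat.totient k)‖ *
          ‖A k - R * ((D : ℝ) * p * k : ℝ) * B k‖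
        ≤ 1 / ((k : ℝ) * Nat.totient k) * (C' * alpha D ^ 20 * ((D : ℝ) * p * k)) :=
          mul_le_mul hc (hk k hkK) (norm_nonneg _) (by positivity)
      _ = C' * alpha D ^ 20 * ((D : ℝ) * p) * (1 / (Nat.totient k : ℝ)) := by
          field_simp
  have hnorminv : ‖(Nat.totient D : ℂ)⁻¹‖ = (Nat.totient D : ℝ)⁻¹ := by
    rw [norm_inv, Complex.norm_natCast]
  have hsumφ := sum_inv_totient_le_P4 (D := D) hℓ1
  have hα := alpha_pow_twenty_mul_le (D := D) hℓ1
  calc ‖(Nat.totient D : ℂ)⁻¹ * ∑ k ∈ Finset.Icc 1 K,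
        (ArithmeticFunction.moebius k : ℂ) * χ (k : ZMod D) / ((k : ℂ) * Nat.totient k) *
          (A k - R * ((D : ℝ) * p * k : ℝ) * B k)‖
      ≤ (Nat.totient D : ℝ)⁻¹ * ∑ k ∈ Finset.Icc 1 K,
          C' * alpha D ^ 20 * ((D : ℝ) * p) * (1 / (Nat.totient k : ℝ)) := by
        rw [norm_mul, hnorminv]
        exact mul_le_mul_of_nonneg_left ((norm_sum_le _ _).trans (Finset.sum_le_sum hcoef))
          (by positivity)
    _ = C' * alpha D ^ 20 * ((D : ℝ) / (Nat.totient D : ℝ)) * p *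
          ∑ k ∈ Finset.Icc 1 K, 1 / (Nat.totient k : ℝ) := by
        rw [← Finset.mul_sum]; field_simp
    _ ≤ C' * alpha D ^ 20 * (16 * Real.exp (11 / 2) * ell D ^ 2) * p * (6300 * ell D ^ 9) := by
        gcongr
    _ = M / π ^ 20 * (alpha D ^ 20 * ell D ^ 11) * p := by
        simp only [hM]; field_simp
    _ ≤ M / π ^ 20 * (π ^ 20 / ell D) * p := by gcongr
    _ = M / ell D * p := by field_simp
    _ ≤ ε * p := by
        refine mul_le_mul_of_nonneg_right ?_ hpR.le
        rw [div_le_iff₀ hℓ0]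
        have h1 : M / ε ≤ ell D := by linarith
        have h2 := (div_le_iff₀ hε).mp h1
        linarith

end Main

end Literature.NumberTheory.LFunctions.Zhang2022.Typed.Section16A
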